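import Summits.MatrixMultiplication.OmegaCensus.SmallFormats.MatMul22nRankGF7Slack6FlatMain
import HarnessLib

/-!
# ω-census family (a): slack-6 certificate replay — MAIN CHECK (bucket completeness + level-1 expansion), file 95 of 114

Cell `pub-omega` (unit `pub-omega-tensor-g18`, `pub-omega-tensor-g19`), topic `Summits/MatrixMultiplication/OmegaCensus` (sub-folder `SmallFormats`).
Framing (verbatim): lottery ticket; floor = certified bounds/negative ranges. HONEST FRAMING: machine-generated kernel replay
(`pub-omega-tensor-g19/code/py/gen6_runs19.py`, from tensor g18's `gen6_runs18.py`): `LanesOK6 h 0 3692` (every lane of the total plane passes `laneOK6`) for the elements `278 ≤ h < 280` of `PGL₂(7)` (lane pieces `mainOK6K` (flat lane checker, literal plane) of ≤ 2400 level-1 loop nodes, 8343 in this file, glued by `lanesOK6_of_piece` / `lanesOK6_append`). Soundness is in `MatMul22nRankGF7Slack6SearchSound` /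
`MatMul22nRankGF7Slack6SearchFinal`; nothing here is progress on `ω`.
-/

namespace Summit.MatrixMultiplication.OmegaCensus.SmallFormats

set_option Elab.async false

set_option maxRecDepth 100000 in
set_option maxHeartbeats 400000000 in
/-- Element `278`: lanes `0 ≤ c < 1015` of the total plane pass (2398 level-1 loop search nodes). -/
theorem mainOK6K_278_0 : mainOK6K 278 0 1015 = true := by decide +kernel

set_option maxRecDepth 100000 in
set_option maxHeartbeats 400000000 in
/-- Element `278`: lanes `1015 ≤ c < 1966` of the total plane pass (2398 level-1 loop search nodes). -/
theorem mainOK6K_278_1 : mainOK6K 278 1015 951 = true := by decide +kernel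

set_option maxRecDepth 100000 in
set_option maxHeartbeats 400000000 in
/-- Element `278`: lanes `1966 ≤ c < 3679` of the total plane pass (2399 level-1 loop search nodes). -/
theorem mainOK6K_278_2 : mainOK6K 278 1966 1713 = true := by decide +kernel

set_option maxRecDepth 100000 in
set_option maxHeartbeats 400000000 in
/-- Element `278`: lanes `3679 ≤ c < 3692` of the total plane pass (3 level-1 loop search nodes). -/
theorem mainOK6K_278_3 : mainOK6K 278 3679 13 = true := by decide +kernel

/-- **All 3 692 lanes of element `278` pass** (4 pieces; 7198 loop search nodes). -/
theorem lanesOK6_h278 : LanesOK6 278 0 3692 := (lanesOK6_append (lanesOK6_append (lanesOK6_append (lanesOK6_of_pieceK mainOK6K_278_0) (lanesOK6_of_pieceK mainOK6K_278_1)) (lanesOK6_of_pieceK mainOK6K_278_2)) (lanesOK6_of_pieceK mainOK6K_278_3))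

set_option maxRecDepth 100000 in
set_option maxHeartbeats 400000000 in
/-- Element `279`: lanes `0 ≤ c < 3692` of the total plane pass (1145 level-1 loop search nodes). -/
theorem mainOK6K_279_0 : mainOK6K 279 0 3692 = true := by decide +kernel

/-- **All 3 692 lanes of element `279` pass** (1 pieces; 1145 loop search nodes). -/
theorem lanesOK6_h279 : LanesOK6 279 0 3692 := (lanesOK6_of_pieceK mainOK6K_279_0)

/-- **MAIN CHECK lanes for `278 ≤ · < 280`** (this file). -/
theorem lanesOK6_runM_95 : ∀ x, 278 ≤ x → x < 280 → LanesOK6 x 0 3692 := by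
  intro x _h1 h2
  by_cases g279 : x < 279
  · have e : x = 278 := by omega
    subst e; exact lanesOK6_h278
  have e : x = 279 := by omega
  subst e; exact lanesOK6_h279

end Summit.MatrixMultiplication.OmegaCensus.SmallFormats
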